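import Summits.Ventures.PercRepro.RankLevelSetLevelNineArithCubeAK
import Summits.Ventures.PercRepro.RankLevelSetLevelNineArithCubeAL
import Summits.Ventures.PercRepro.RankLevelSetLevelNineArithCubeAM
import Summits.Ventures.PercRepro.RankLevelSetLevelNineArithCubeAN
import Summits.Ventures.PercRepro.RankLevelSetLevelNineArithCubeAO
import Summits.Ventures.PercRepro.RankLevelSetLevelNineArithCubeAP
import Summits.Ventures.PercRepro.RankLevelSetLevelNineArithCubeAQ
import Summits.Ventures.PercRepro.RankLevelSetLevelNineArithCubeAR
import Summits.Ventures.PercRepro.RankLevelSetLevelNineArithCubeAS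
import Summits.Ventures.PercRepro.RankLevelSetLevelNineArithCubeAT

/-!
# PercRepro — THE LEVEL-`9` DISPATCHER OF THE PARTITION CHAIN WITH THE CUBIC MULTIPLICITY, PART ZB: `(P_d)` for `90 ≤ d ≤ 169`,
`p ≥ 381` (p4, gen 16; a feeder for S4). Axioms: standard.
-/

namespace PercRepro

namespace ThmN

/-- `(P_d)` at level `9` for `90 ≤ d ≤ 169`, `p ≥ 381`, in `ℚ`. -/
theorem level_nine_poly_cube_ZB (d : ℕ) (hd1 : 90 ≤ d) (hd2 : d ≤ 169) (p : ℕ) (hp : 381 ≤ p) :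
    8 * ((((p + d).choose 9 : ℕ) : ℚ) + (∑ j ∈ Finset.range (d - 9), ((Nat.choose (min 309 (max ((d + min 151 d) / 2 + 1) (min 150 (d - 1) + 2) - 2)) j : ℕ) : ℚ) / (((j + 1) + 3 * (j + 1).choose 2 + 3 * (j + 1).choose 3 : ℕ) : ℚ)) *
      (((d * (d + 1) / 2 : ℕ) : ℚ) * ((p + d).choose 7 : ℚ) + ((d * (d + 1) * (d + 2) / 3 : ℕ) : ℚ) * ((p + d).choose 6 : ℚ) + (((d + 4).choose 5 : ℕ) : ℚ) * ((p + d).choose 5 : ℚ) + (((d + 5).choose 6 : ℕ) : ℚ) * ((p + d).choose 4 : ℚ) + (((d + 6).choose 7 : ℕ) : ℚ) * ((p + d).choose 3 : ℚ) + (((d + 7).choose 8 : ℕ) : ℚ) * ((p + d).choose 2 : ℚ) + (((d + 8).choose 9 : ℕ) : ℚ) * (p + d : ℚ) + (((d + 9).choose 10 : ℕ) : ℚ)) +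
      ((∑ j ∈ Finset.range (d - 9), ((Nat.choose (min 319 (9 + d) - 10) j : ℕ) : ℚ) / (((j + 1) + 3 * (j + 1).choose 2 + 3 * (j + 1).choose 3 : ℕ) : ℚ)) - (∑ j ∈ Finset.range (d - 9), ((Nat.choose (min 150 (d - 1)) j : ℕ) : ℚ) / (((j + 1) + 3 * (j + 1).choose 2 + 3 * (j + 1).choose 3 : ℕ) : ℚ))) *
      ((d * (d + 1) / 2 * (min 319 (9 + d)).choose 7 + d * (d + 1) * (d + 2) / 3 * (min 319 (9 + d)).choose 6 + (d + 4).choose 5 * (min 319 (9 + d)).choose 5 + (d + 5).choose 6 * (min 319 (9 + d)).choose 4 + (d + 6).choose 7 * (min 319 (9 + d)).choose 3 + (d + 7).choose 8 * (min 319 (9 + d)).choose 2 + (d + 8).choose 9 * (min 319 (9 + d)) + (d + 9).choose 10 : ℕ) : ℚ)) ≤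
      7 * 2 ^ (d - 9) * (((p + 9).choose 9 : ℕ) : ℚ) := by
  interval_cases d
  · exact level_nine_poly_cube_90 p hp
  · exact level_nine_poly_cube_91 p hp
  · exact level_nine_poly_cube_92 p hp
  · exact level_nine_poly_cube_93 p hp
  · exact level_nine_poly_cube_94 p hp
  · exact level_nine_poly_cube_95 p hp
  · exact level_nine_poly_cube_96 p hp
  · exact level_nine_poly_cube_97 p hp
  · exact level_nine_poly_cube_98 p hp
  · exact level_nine_poly_cube_99 p hp
  · exact level_nine_poly_cube_100 p hp
  · exact level_nine_poly_cube_101 p hp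
  · exact level_nine_poly_cube_102 p hp
  · exact level_nine_poly_cube_103 p hp
  · exact level_nine_poly_cube_104 p hp
  · exact level_nine_poly_cube_105 p hp
  · exact level_nine_poly_cube_106 p hp
  · exact level_nine_poly_cube_107 p hp
  · exact level_nine_poly_cube_108 p hp
  · exact level_nine_poly_cube_109 p hp
  · exact level_nine_poly_cube_110 p hp
  · exact level_nine_poly_cube_111 p hp
  · exact level_nine_poly_cube_112 p hp
  · exact level_nine_poly_cube_113 p hp
  · exact level_nine_poly_cube_114 p hp
  · exact level_nine_poly_cube_115 p hp
  · exact level_nine_poly_cube_116 p hp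
  · exact level_nine_poly_cube_117 p hp
  · exact level_nine_poly_cube_118 p hp
  · exact level_nine_poly_cube_119 p hp
  · exact level_nine_poly_cube_120 p hp
  · exact level_nine_poly_cube_121 p hp
  · exact level_nine_poly_cube_122 p hp
  · exact level_nine_poly_cube_123 p hp
  · exact level_nine_poly_cube_124 p hp
  · exact level_nine_poly_cube_125 p hp
  · exact level_nine_poly_cube_126 p hp
  · exact level_nine_poly_cube_127 p hp
  · exact level_nine_poly_cube_128 p hp
  · exact level_nine_poly_cube_129 p hp
  · exact level_nine_poly_cube_130 p hp
  · exact level_nine_poly_cube_131 p hp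
  · exact level_nine_poly_cube_132 p hp
  · exact level_nine_poly_cube_133 p hp
  · exact level_nine_poly_cube_134 p hp
  · exact level_nine_poly_cube_135 p hp
  · exact level_nine_poly_cube_136 p hp
  · exact level_nine_poly_cube_137 p hp
  · exact level_nine_poly_cube_138 p hp
  · exact level_nine_poly_cube_139 p hp
  · exact level_nine_poly_cube_140 p hp
  · exact level_nine_poly_cube_141 p hp
  · exact level_nine_poly_cube_142 p hp
  · exact level_nine_poly_cube_143 p hp
  · exact level_nine_poly_cube_144 p hp
  · exact level_nine_poly_cube_145 p hp
  · exact level_nine_poly_cube_146 p hp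
  · exact level_nine_poly_cube_147 p hp
  · exact level_nine_poly_cube_148 p hp
  · exact level_nine_poly_cube_149 p hp
  · exact level_nine_poly_cube_150 p hp
  · exact level_nine_poly_cube_151 p hp
  · exact level_nine_poly_cube_152 p hp
  · exact level_nine_poly_cube_153 p hp
  · exact level_nine_poly_cube_154 p hp
  · exact level_nine_poly_cube_155 p hp
  · exact level_nine_poly_cube_156 p hp
  · exact level_nine_poly_cube_157 p hp
  · exact level_nine_poly_cube_158 p hp
  · exact level_nine_poly_cube_159 p hp
  · exact level_nine_poly_cube_160 p hp
  · exact level_nine_poly_cube_161 p hp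
  · exact level_nine_poly_cube_162 p hp
  · exact level_nine_poly_cube_163 p hp
  · exact level_nine_poly_cube_164 p hp
  · exact level_nine_poly_cube_165 p hp
  · exact level_nine_poly_cube_166 p hp
  · exact level_nine_poly_cube_167 p hp
  · exact level_nine_poly_cube_168 p hp
  · exact level_nine_poly_cube_169 p hp

end ThmN

end PercRepro
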